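import Summits.BirchSwinnertonDyer.Rank1Residual.X11b.Three.UnrSeriesTwist
import Mathlib.Analysis.Normed.Group.FunctionSeries
import HarnessLib

/-!
# X11b, S23 (glue (g2) of the S18 frame), part 2: continuous additive characters `χ : ℤ_p → ℂ_p`,
# `(1 + T)^a (u - 1) = u^a` for the principal unit `u = χ(1)`, and the `κ`-bridge for `p`-adic avatars
# (every prime `p`; theorems only)

HONEST FRAMING (cell `b2b-bsdres`, run/shared/lean/b2b/bsd-rank1-residual/, verbatim in every
file): the goal of the cell is to DELETE the COMBINATION-SHAPED residual classes of the
Birch–Swinnerton-Dyer formula for ALL analytic-rank `≤ 1` elliptic curves over `ℚ` — "full BSD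
formula for every rank `≤ 1` curve in class `C`" assembled STRICTLY from published theorems — so
that the rank-`≤ 1` remainder becomes exactly the CONSTRUCTION-SHAPED classes, which are TYPED
(missing-input `Prop`s), NOT attempted. This is not "finishing BSD". Team `x11b3` = N8/O2 (X11b at
`p = 3`: `3 ‖ N`, `r_an = 1`, `E[3]` irreducible): RESEARCH ROUTES; published theorems only; the
construction-shaped remainder is TYPED, not attempted; census output = EVIDENCE, never a Literature
fact; nothing booked; no label change; O2 stays OPEN; no route opened.

PROVENANCE (team `cells/x11b3/`, LEAD DEAL #7 R7-37, sub-target S23 = glue (g2) of route planner 2's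
frame memo `HOME/b2b-bsdres-x11b3-r2/gen6/D3EPS.md` §4.1, seat `b2b-bsdres-x11b3-p3` gen. 4; sequel
of `UnrSeriesTwist.lean`, which has `(1 + T)^a := (binomialSeries ℤ_[p] a).map (toUnr p) ∈ R₀⟦T⟧` and
the product rule `hasValueAt_mul`). Here: **`u^a` for `a ∈ ℤ_p` and a principal unit `u` of `ℂ_p`
IS `χ(a)` for the continuous additive character `χ : ℤ_p → ℂ_p` (`AddChar ℤ_[p] ℂ_[p]`) with
`χ(1) = u`** — the only meaning the expression `φ̂(γ)^{κ(σ)}` of the S18 re-normalisation can have;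
for the `p`-adic avatar `r = φ̂` of a Hecke character factoring through the `ℤ_p`-extension `κ` with
topological generator `γ` the character is `a ↦ r(κ⁻¹ a)` and `u = r(γ)` (§4). No new definition.

## What is kernel-checked here (THEOREMS only; no definition, no fact, no hypothesis shape)

* §3 continuous additive characters `χ : ℤ_p → ℂ_p`: **`norm_map_one_sub_one_lt`** — `‖χ(1) - 1‖ < 1`
  is PROVED (if `‖u - 1‖ ≥ 1` then `‖u^{p^n} - 1‖ ≥ 1` for all `n`, by the divisibility of the middle
  binomial coefficients `C(p, k)` by `p` and the ultrametric inequality; but `χ(p^n) → χ(0) = 1`), so it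
  is never a binder; **`hasValueAt_binomialSeries_addChar`** — `(1 + T)^a` at `T = χ(1) - 1` has value
  `χ(a)` for EVERY `a ∈ ℤ_p` (the series `a ↦ ∑_k C(a,k) x^k` is continuous on `ℤ_p` by the uniform
  bound `‖x‖^k` and Mathlib's `PadicInt.continuous_choose`, and agrees with `χ` on the dense `ℕ`);
  **`hasValueAt_binomialSeries_mul_addChar`** = glue (g2) verbatim:
  `((1 + T)^a · L)(χ(1) - 1) = χ(a) · L(χ(1) - 1)`;
* §4 the same read through a `ℤ_p`-extension `κ : Γ_K ↠ ℤ_p` with topological generator `γ` and a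
  rank-one `p`-adic Galois character `r` factoring through `κ` (`FactorsThroughZp κ r`, the binder of
  `IsBDPLFunction`): `continuous_avatarValueAt`, `exists_addChar_of_factorsThroughZp` (the continuous
  character `a ↦ r(κ⁻¹ a)`; continuity because `Γ_K` is compact, so `κ` is a quotient map),
  **`hasValueAt_binomialSeries_avatar`**: `(1 + T)^{κ(σ)}` at `T = r(γ) - 1` has value `r(σ)`, i.e.
  "`r(σ) = r(γ)^{κ(σ)}`" (D3EPS (g3), second clause), `norm_avatarValueAt_sub_one_lt` (`r(γ) - 1` lies
  in the open unit disc, where every `L ∈ R₀⟦T⟧` converges), and `hasValueAt_binomialSeries_mul_avatar`.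

## What this does NOT do
No `p`-adic `L`-function is constructed or re-normalised here, nothing is asserted about elliptic
curves, Hecke characters or Frobenius elements ((g3)'s first clause — `r(Frob_v) = ι⁻¹(φ(ϖ_v))` from
`IsPAdicAvatarOf` — and (g1) are the S18(b) hand's). Nothing is booked; no label changes; O2 stays OPEN.

References: [Castella2018] §2.2, Thm. 3.1 (arXiv:1704.06608 pp. 5, 9); [CastellaHsieh2018] §3.3 (the
avatar `φ̂` as a Galois character, arXiv:1505.08165 p. 9); D3EPS.md §0/§3/§4.1 (r2 gen. 6, sha16
25d7c5f721ee6066); Mathlib `NumberTheory/Padics/MahlerBasis` (`PadicInt.continuous_choose`,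
`PadicInt.denseRange_natCast`), `Analysis/Normed/Group/FunctionSeries` (`continuous_tsum`).
-/

noncomputable section

open Filter Topology PowerSeries
open Literature.NumberTheory.EllipticCurves Literature.NumberTheory.GaloisRepresentations Field

namespace Summit.BirchSwinnertonDyer.Rank1Residual.X11b.Halves

universe u

variable {p : ℕ} [Fact p.Prime]

/-! ## §3 Continuous additive characters of `ℤ_p` with values in `ℂ_p`: `‖χ(1) - 1‖ < 1` and
`(1 + T)^a (χ(1) - 1) = χ(a)` (every prime `p`) -/

section Character

/-- If `u ∉ 1 + 𝔪` (`‖u - 1‖ ≥ 1`) then `u^p ∉ 1 + 𝔪` (Frobenius is injective on the residue field;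
for `‖u‖ ≤ 1` this is the tree's `norm_sub_one_lt_one_of_pow_prime` — the middle binomial
coefficients `C(p, k)` are divisible by `p` —, for `‖u‖ > 1` one has `‖u^p - 1‖ = ‖u‖^p`).
[folklore] -/
theorem one_le_norm_pow_prime_sub_one {u : ℂ_[p]} (hu : 1 ≤ ‖u - 1‖) : 1 ≤ ‖u ^ p - 1‖ := by
  have hp : p.Prime := Fact.out
  by_cases h1 : ‖u‖ ≤ 1
  · have hle : ‖u - 1‖ ≤ 1 := by
      rw [sub_eq_add_neg]
      refine (IsUltrametricDist.norm_add_le_max _ _).trans (max_le h1 ?_)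
      rw [norm_neg, norm_one]
    by_contra hlt
    rw [not_le] at hlt
    exact (norm_sub_one_lt_one_of_pow_prime hle hlt).not_ge hu
  · rw [not_le] at h1
    have hup : 1 < ‖u ^ p‖ := by rw [norm_pow]; exact one_lt_pow₀ h1 hp.ne_zero
    have hne : ‖u ^ p‖ ≠ ‖(-1 : ℂ_[p])‖ := by
      rw [norm_neg, norm_one]; exact ne_of_gt hup
    rw [sub_eq_add_neg, IsUltrametricDist.norm_add_eq_max_of_norm_ne_norm hne, norm_neg, norm_one]
    exact hup.le.trans (le_max_left _ _)

/-- Iterating: `‖u - 1‖ ≥ 1 ⟹ ‖u^{p^n} - 1‖ ≥ 1` for every `n`. [folklore] -/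
theorem one_le_norm_pow_prime_pow_sub_one {u : ℂ_[p]} (hu : 1 ≤ ‖u - 1‖) (n : ℕ) :
    1 ≤ ‖u ^ p ^ n - 1‖ := by
  induction n with
  | zero => simpa using hu
  | succ n ih =>
    rw [pow_succ, pow_mul]
    exact one_le_norm_pow_prime_sub_one ih

/-- A character takes the value `χ(1)^n` at `n ∈ ℕ`. [folklore] -/
theorem addChar_apply_natCast (χ : AddChar ℤ_[p] ℂ_[p]) (n : ℕ) : χ (n : ℤ_[p]) = χ 1 ^ n := by
  rw [← nsmul_one, AddChar.map_nsmul_eq_pow]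

/-- **A continuous additive character `χ : ℤ_p → ℂ_p` has `χ(1) ∈ 1 + 𝔪_{ℂ_p}`: `‖χ(1) - 1‖ < 1`.**
(`p^n → 0` in `ℤ_p`, so `χ(1)^{p^n} = χ(p^n) → χ(0) = 1`; but `‖u - 1‖ ≥ 1` forces
`‖u^{p^n} - 1‖ ≥ 1`.) In particular the value `φ̂(γ)` of a `p`-adic avatar at a topological generator
is a principal unit and `φ̂(γ) - 1` lies in the open unit disc where every `L ∈ R₀⟦T⟧` converges —
a CONSEQUENCE, not a binder. [folklore] -/
theorem norm_map_one_sub_one_lt (χ : AddChar ℤ_[p] ℂ_[p]) (hχ : Continuous χ) : ‖χ 1 - 1‖ < 1 := by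
  have hp : p.Prime := Fact.out
  by_contra h
  rw [not_lt] at h
  have h0 : Tendsto (fun n : ℕ ↦ (p : ℤ_[p]) ^ n) atTop (𝓝 0) :=
    tendsto_pow_atTop_nhds_zero_of_norm_lt_one
      (by rw [PadicInt.norm_p]; exact inv_lt_one_of_one_lt₀ (by exact_mod_cast hp.one_lt))
  have hlim : Tendsto (fun n : ℕ ↦ χ ((p : ℤ_[p]) ^ n)) atTop (𝓝 1) := by
    have h := (hχ.tendsto 0).comp h0
    rwa [AddChar.map_zero_eq_one] at h
  have hev : ∀ n : ℕ, χ ((p : ℤ_[p]) ^ n) = χ 1 ^ p ^ n := fun n ↦ by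
    rw [← Nat.cast_pow, addChar_apply_natCast]
  obtain ⟨n, hn⟩ : ∃ n : ℕ, ‖χ ((p : ℤ_[p]) ^ n) - 1‖ < 1 := by
    obtain ⟨n, hn⟩ := ((Metric.tendsto_nhds.mp hlim) 1 one_pos).exists
    exact ⟨n, by rwa [dist_eq_norm] at hn⟩
  rw [hev] at hn
  exact (one_le_norm_pow_prime_pow_sub_one h n).not_gt hn

/-- **`(1 + T)^a` evaluated at `T = χ(1) - 1` is `χ(a)`, for EVERY `a ∈ ℤ_p`** and every continuous
additive character `χ : ℤ_p → ℂ_p` — i.e. `(1 + T)^a (u - 1) = u^a` for the principal unit `u = χ(1)`,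
where `u^a := χ(a)` is the only continuous extension of `n ↦ u^n`. Proof: with `x = χ(1) - 1`,
`‖x‖ < 1` (`norm_map_one_sub_one_lt`); `a ↦ ∑_k C(a,k) x^k` is continuous on `ℤ_p` (uniform bound
`‖x‖^k`, `Ring.choose · k` continuous — Mathlib `PadicInt.continuous_choose`) and equals
`(1 + x)^n = χ(n)` at `n ∈ ℕ`; `ℕ` is dense in `ℤ_p`. [folklore] -/
theorem hasValueAt_binomialSeries_addChar (χ : AddChar ℤ_[p] ℂ_[p]) (hχ : Continuous χ) (a : ℤ_[p]) :
    UnrSeries.HasValueAt ((binomialSeries ℤ_[p] a).map (toUnr p)) (χ 1 - 1) (χ a) := by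
  set x : ℂ_[p] := χ 1 - 1 with hx
  have hx1 : ‖x‖ < 1 := norm_map_one_sub_one_lt χ hχ
  -- the terms of the series, as functions of the exponent
  set T : ℕ → ℤ_[p] → ℂ_[p] :=
    fun k b ↦ algebraMap ℚ_[p] ℂ_[p] ((Ring.choose b k : ℤ_[p]) : ℚ_[p]) * x ^ k with hT
  have hTn : ∀ k b, ‖T k b‖ ≤ ‖x‖ ^ k := fun k b ↦ by
    rw [hT]
    dsimp only
    rw [norm_mul, norm_pow, norm_algebraMap', ← PadicInt.norm_def]
    exact mul_le_of_le_one_left (pow_nonneg (norm_nonneg _) _) (PadicInt.norm_le_one _)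
  have hTc : ∀ k, Continuous (T k) := fun k ↦
    ((continuous_algebraMap ℚ_[p] ℂ_[p]).comp
      (continuous_subtype_val.comp (PadicInt.continuous_choose k))).mul continuous_const
  have hgeom : Summable fun k : ℕ ↦ ‖x‖ ^ k := summable_geometric_of_lt_one (norm_nonneg _) hx1
  -- the sum, as a function of the exponent: continuous, with the series converging to it
  set F : ℤ_[p] → ℂ_[p] := fun b ↦ ∑' k, T k b with hF
  have hFc : Continuous F := continuous_tsum hTc hgeom hTn
  have hFsum : ∀ b, HasSum (fun k ↦ T k b) (F b) := fun b ↦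
    (hgeom.of_nonneg_of_le (fun _ ↦ norm_nonneg _) (fun k ↦ hTn k b)).of_norm.hasSum
  -- on `ℕ` it is `(1 + x)^n = χ(1)^n = χ(n)`
  have hFnat : ∀ n : ℕ, F n = χ 1 ^ n := by
    intro n
    have hfin : HasSum (fun k ↦ T k (n : ℤ_[p])) (∑ k ∈ Finset.range (n + 1), T k n) :=
      hasSum_sum_of_ne_finset_zero fun k hk ↦ by
        have hnk : n < k := by simpa [Finset.mem_range, Nat.lt_succ_iff] using hk
        rw [hT]
        dsimp only
        rw [Ring.choose_natCast, Nat.choose_eq_zero_of_lt hnk, Nat.cast_zero, PadicInt.coe_zero,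
          map_zero, zero_mul]
    rw [(hFsum n).unique hfin, show χ 1 = x + 1 by rw [hx, sub_add_cancel], add_pow]
    refine Finset.sum_congr rfl fun k _ ↦ ?_
    rw [hT]
    dsimp only
    rw [Ring.choose_natCast, PadicInt.coe_natCast, map_natCast, one_pow, mul_one]
    ring
  have hχnat : ∀ n : ℕ, χ (n : ℤ_[p]) = χ 1 ^ n := addChar_apply_natCast χ
  -- density of `ℕ` in `ℤ_p`
  have hFχ : F = χ := PadicInt.denseRange_natCast.equalizer hFc hχ
    (funext fun n ↦ by simp only [Function.comp_apply, hFnat, hχnat])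
  -- conclusion
  have h := hFsum a
  rw [show F a = χ a from congrFun hFχ a] at h
  unfold UnrSeries.HasValueAt
  convert h using 1
  funext k
  rw [coe_coeff_binomialSeries_map]

/-- **Glue (g2), verbatim (D3EPS §4.1)**: for a continuous additive character `χ : ℤ_p → ℂ_p` with
`u = χ(1)` and any `L ∈ R₀⟦T⟧` with `L(u - 1) = v`:
`((1 + T)^a · L)(u - 1) = u^a · v`, `u^a = χ(a)`, for every `a ∈ ℤ_p`. [folklore] -/
theorem hasValueAt_binomialSeries_mul_addChar (χ : AddChar ℤ_[p] ℂ_[p]) (hχ : Continuous χ)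
    (a : ℤ_[p]) {L : UnrSeries p} {v : ℂ_[p]} (hL : L.HasValueAt (χ 1 - 1) v) :
    UnrSeries.HasValueAt ((binomialSeries ℤ_[p] a).map (toUnr p) * L) (χ 1 - 1) (χ a * v) :=
  hasValueAt_mul (norm_map_one_sub_one_lt χ hχ) (hasValueAt_binomialSeries_addChar χ hχ a) hL

/-- The inverse twist undoes the twist at the level of values: `((1 + T)^{-a} · L)(u - 1) = χ(-a) · v`
with `χ(-a) · χ(a) = 1`. [folklore] -/
theorem addChar_neg_mul_self (χ : AddChar ℤ_[p] ℂ_[p]) (a : ℤ_[p]) : χ (-a) * χ a = 1 := by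
  rw [← AddChar.map_add_eq_mul, neg_add_cancel, AddChar.map_zero_eq_one]

end Character

/-! ## §4 Through a `ℤ_p`-extension: `(1 + T)^{κ(σ)} (r(γ) - 1) = r(σ)` for a rank-one `p`-adic Galois
character `r` factoring through `κ` (every prime `p`) -/

section Avatar

variable {K : Type u} [Field K] [NumberField K]

omit [NumberField K] in
/-- `γ ↦ φ̂(γ) ∈ ℂ_p` is continuous (`r : Γ_K →ₜ* GL₁(ℚ̄_p)` is continuous, `det`, `ℚ̄_p ⊂ ℂ_p`).
[folklore] -/
theorem continuous_avatarValueAt (r : FramedGaloisRep K (PadicAlgCl p) 1) :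
    Continuous (avatarValueAt r) := by
  have h : avatarValueAt r = fun γ ↦ (((r γ : Matrix (Fin 1) (Fin 1) (PadicAlgCl p)).det :
      PadicAlgCl p) : ℂ_[p]) := by
    funext γ
    rw [avatarValueAt, Matrix.GeneralLinearGroup.val_det_apply]
  rw [h]
  exact (UniformSpace.Completion.continuous_coe _).comp
    ((Units.continuous_val.comp (map_continuous r)).matrix_det)

/-- **The character of `Γ = Γ_K / ker κ ≅ ℤ_p` cut out by `r`.** If the rank-one Galois character `r`
factors through the `ℤ_p`-extension `κ : Γ_K ↠ ℤ_p` (`FactorsThroughZp κ r`), then `a ↦ r(κ⁻¹ a)` is a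
well-defined CONTINUOUS additive character `χ : ℤ_p → ℂ_p` with `χ(κ σ) = r(σ)` (continuity: `Γ_K` is
compact and `ℤ_p` Hausdorff, so `κ` is a quotient map). [folklore] -/
theorem exists_addChar_of_factorsThroughZp {κ : ZpExtension K p}
    {r : FramedGaloisRep K (PadicAlgCl p) 1} (hr : FactorsThroughZp κ r) :
    ∃ χ : AddChar ℤ_[p] ℂ_[p], Continuous χ ∧
      ∀ σ : absoluteGaloisGroup K, χ (κ σ).toAdd = avatarValueAt r σ := by
  set π : absoluteGaloisGroup K → ℤ_[p] := fun σ ↦ (κ σ).toAdd with hπ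
  have hπc : Continuous π := continuous_toAdd.comp (map_continuous κ)
  have hπs : Function.Surjective π := fun a ↦ by
    obtain ⟨σ, hσ⟩ := κ.surjective (Multiplicative.ofAdd a)
    refine ⟨σ, ?_⟩
    rw [hπ]
    dsimp only
    rw [show κ σ = Multiplicative.ofAdd a from hσ, toAdd_ofAdd]
  have hπmul : ∀ σ τ, π (σ * τ) = π σ + π τ := fun σ τ ↦ by
    rw [hπ]
    dsimp only
    rw [map_mul, toAdd_mul]
  -- `r` is constant on the fibres of `π`
  have hwd : ∀ σ τ, π σ = π τ → avatarValueAt r σ = avatarValueAt r τ := by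
    intro σ τ h
    have h1 : κ (σ⁻¹ * τ) = 1 := by
      have h' : κ σ = κ τ := Multiplicative.toAdd.injective h
      rw [map_mul, map_inv, h', inv_mul_cancel]
    rw [← mul_inv_cancel_left σ τ, avatarValueAt_mul,
      avatarValueAt_eq_one_of_factorsThroughZp hr h1, mul_one]
  -- a set-theoretic section of `π` and the induced function
  set s : ℤ_[p] → absoluteGaloisGroup K := Function.surjInv hπs with hs
  have hπs' : ∀ a, π (s a) = a := Function.surjInv_eq hπs
  set χf : ℤ_[p] → ℂ_[p] := fun a ↦ avatarValueAt r (s a) with hχf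
  have hχπ : ∀ σ, χf (π σ) = avatarValueAt r σ := fun σ ↦ hwd _ _ (hπs' _)
  refine ⟨{ toFun := χf, map_zero_eq_one' := ?_, map_add_eq_mul' := ?_ }, ?_, fun σ ↦ hχπ σ⟩
  · have h10 : π 1 = 0 := by
      rw [hπ]
      dsimp only
      rw [map_one, toAdd_one]
    rw [← h10, hχπ, avatarValueAt_one]
  · intro a b
    have hab : π (s a * s b) = a + b := by rw [hπmul, hπs', hπs']
    calc χf (a + b) = χf (π (s a * s b)) := by rw [hab]
      _ = avatarValueAt r (s a * s b) := hχπ _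
      _ = avatarValueAt r (s a) * avatarValueAt r (s b) := avatarValueAt_mul r _ _
      _ = χf a * χf b := rfl
  · have hq : IsQuotientMap π := hπc.isClosedMap.isQuotientMap hπc hπs
    show Continuous χf
    rw [hq.continuous_iff, show χf ∘ π = avatarValueAt r from funext hχπ]
    exact continuous_avatarValueAt r

/-- **`(1 + T)^{κ(σ)}` evaluated at `T = r(γ) - 1` is `r(σ)`** — "`r(σ) = r(γ)^{κ(σ)}`" (D3EPS (g3),
second clause) — for a topological generator `γ` (`κ γ = 1`) and a rank-one character `r` factoring
through `κ`; e.g. `σ = g_𝔭̄` or `σ_𝔉` with `κ(σ) ∈ ℤ_p`, in general not in `ℤ`. [folklore] -/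
theorem hasValueAt_binomialSeries_avatar {κ : ZpExtension K p} {γ : absoluteGaloisGroup K}
    (hγ : κ.IsTopGenerator γ) {r : FramedGaloisRep K (PadicAlgCl p) 1} (hr : FactorsThroughZp κ r)
    (σ : absoluteGaloisGroup K) :
    UnrSeries.HasValueAt ((binomialSeries ℤ_[p] (κ σ).toAdd).map (toUnr p))
      (avatarValueAt r γ - 1) (avatarValueAt r σ) := by
  obtain ⟨χ, hχc, hχ⟩ := exists_addChar_of_factorsThroughZp hr
  have h1 : χ 1 = avatarValueAt r γ := by
    have h := hχ γ
    rwa [show κ γ = Multiplicative.ofAdd 1 from hγ, toAdd_ofAdd] at h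
  rw [← h1, ← hχ σ]
  exact hasValueAt_binomialSeries_addChar χ hχc _

/-- `‖r(γ) - 1‖ < 1`: the value of the avatar at the topological generator is a principal unit, so
`T = r(γ) - 1` (the point at which `IsBDPLFunction` reads values) lies in the open unit disc where every
`L ∈ R₀⟦T⟧` converges (`exists_hasValueAt`). [folklore] -/
theorem norm_avatarValueAt_sub_one_lt {κ : ZpExtension K p} {γ : absoluteGaloisGroup K}
    (hγ : κ.IsTopGenerator γ) {r : FramedGaloisRep K (PadicAlgCl p) 1} (hr : FactorsThroughZp κ r) :
    ‖avatarValueAt r γ - 1‖ < 1 := by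
  obtain ⟨χ, hχc, hχ⟩ := exists_addChar_of_factorsThroughZp hr
  have h1 : χ 1 = avatarValueAt r γ := by
    have h := hχ γ
    rwa [show κ γ = Multiplicative.ofAdd 1 from hγ, toAdd_ofAdd] at h
  rw [← h1]
  exact norm_map_one_sub_one_lt χ hχc

/-- **Glue (g2) read through `κ`**: `((1 + T)^{κ(σ)} · L)(r(γ) - 1) = r(σ) · L(r(γ) - 1)` — translating
an element of `Λ_{R₀}` by `γ^{κ(σ)} ↔ (1 + T)^{κ(σ)}` multiplies its value at the character `r` by
`r(σ)`. [folklore] -/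
theorem hasValueAt_binomialSeries_mul_avatar {κ : ZpExtension K p} {γ : absoluteGaloisGroup K}
    (hγ : κ.IsTopGenerator γ) {r : FramedGaloisRep K (PadicAlgCl p) 1} (hr : FactorsThroughZp κ r)
    (σ : absoluteGaloisGroup K) {L : UnrSeries p} {v : ℂ_[p]}
    (hL : L.HasValueAt (avatarValueAt r γ - 1) v) :
    UnrSeries.HasValueAt ((binomialSeries ℤ_[p] (κ σ).toAdd).map (toUnr p) * L)
      (avatarValueAt r γ - 1) (avatarValueAt r σ * v) :=
  hasValueAt_mul (norm_avatarValueAt_sub_one_lt hγ hr) (hasValueAt_binomialSeries_avatar hγ hr σ) hL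

end Avatar

end Summit.BirchSwinnertonDyer.Rank1Residual.X11b.Halves

end
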